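import Summits.CriticalPhenomena.SAWScalingLimit.Theorems.SAWDefectDecoherenceDefectDecoherenceSsTranslationCovariance
import Summits.CriticalPhenomena.SAWScalingLimit.Theorems.SAWDefectDecoherenceDefectDecoherenceSsSectorLipschitzReduction
import Summits.CriticalPhenomena.SAWScalingLimit.Theorems.SAWDefectDecoherenceDefectDecoherenceSsNeighbourArrivalBound
import Summits.CriticalPhenomena.SAWScalingLimit.Theorems.SAWDefectDecoherenceDefectDecoherenceSsStarMassHarnack
import Summits.CriticalPhenomena.SAWScalingLimit.Theorems.SAWDefectDecoherenceDefectDecoherenceSsSourceDiff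
import HarnessLib

/-!
# Stubs 4 and 5 of the line `sector-slaving` from the tip loop bound and SECTOR LIPSCHITZ regularity
(crux `SAWDefectDecoherence.DefectDecoherence`, stmt-CriticalPhenomena-8549; line lead c4; vocabulary
`…/Theorems/SAWDefectDecoherenceSectorSlavingDefs.lean`)

The two rate stubs of the registered skeleton `Cruxes/DefectDecoherence/Lines/sector_slaving.lean`,
`stub_unstableStarGradient : ∃ C θ, 3/4 < θ ∧ DecayBound unstableSource C θ` (decay of the
`∂̄`-difference `Σ_{t ∼ v} ē(t)² U(t)` of the unstable character `U = A_{-3/8}` over the star of an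
`R`-deep vertex `v`) and `stub_signalStarGradient` (the `∂`-difference `Σ_t ē(t) S(t)` of the signal
character `S = A_{5/8}`), are here DERIVED from

* the positive-mass input the line already owes, the tip return-loop bound `N ≤ 8`
  (`TipReturnLoopBound`, a corollary of the existing item `SourceLoopBound`, stmt-CriticalPhenomena-8300,
  by `ss_tipReturnLoopBound_of_sourceLoopBound`), through the landed neighbour Harnack inequality
  `har_neighbourMassBound_of_loopBound`; and
* ONE statement per character, **`SectorLipschitz(ξ)`**: the response of the clean arrival character
  `A_ξ` at an `R`-deep point `z` to a UNIT LATTICE TRANSLATION of the whole configuration `(Λ, a)`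
  (graph automorphisms `T` of `ℍ` acting on centres by `c ↦ c + β`, `‖β‖ ≤ 1`) decays against the star
  mass: `‖A_ξ(z; TΛ, Ta) − A_ξ(z; Λ, a)‖ ≤ C R^{-θ} M(Λ, a, z)`, `θ > 3/4` — sublattice-Lipschitz
  regularity of the sector field, the self-avoiding-walk analogue of the second estimate of
  Chelkak–Smirnov's Theorem 3.12 for s-holomorphic fermions (arXiv:0910.2045), for which no `n = 0`
  proof is known.  It is the OPEN content; nothing about it is proved here.

Mechanism (all landed): the three neighbours of `v` are lattice translates of one another
(`ss_translation_covariance`, exact), the weights `ē(t)^k` sum to zero over the star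
(`ss_sum_conj_dartUnit`, `ss_sum_conj_dartUnit_sq`), so each source is a sum of responses of `A_ξ` at
ONE neighbour to unit translations of `(Λ, a)`; the generic bookkeeping (depth, Harnack, the a-priori
neighbour bound `ss_norm_arrivalSum_nbr_le` for `R < 2`) is `ss_decayBound_weightedStar_of_sectorLipschitz`.
The same `SectorLipschitz(-3/8)` also controls the `∂`-difference `Σ_t ē(t) U(t)` feeding the `S`-row.

Sources: H. Duminil-Copin, S. Smirnov, Ann. of Math. 175 (2012) (arXiv:1007.0575) §2; D. Chelkak,
S. Smirnov, Invent. Math. 189 (2012) (arXiv:0910.2045) Thm 3.12; strategist census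
`Cruxes/DefectDecoherence/STRATEGY-CENSUS.md` ("A reshaping of stubs 4–5 you may prefer").
-/

noncomputable section

open scoped BigOperators ComplexConjugate Classical
open Literature.Probability.LatticeModels Literature.Probability.RandomPlanarGeometry.SAW
open Summit.CriticalPhenomena.SAWScalingLimit.Theorems.DefectDecoherence.TipMartingale

namespace Summit.CriticalPhenomena.SAWScalingLimit.Theorems.DefectDecoherence.SectorSlaving

/-- Norm of a dart unit is at most `1` (it is `1`, or the junk value `0`). [folklore] -/
theorem ss_norm_dartUnit_le_one (v t : HexVertex) : ‖dartUnit v t‖ ≤ 1 := by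
  unfold dartUnit
  rw [norm_div, Complex.norm_real, Real.norm_of_nonneg (norm_nonneg _)]
  by_cases h : ‖hexCenter v - hexCenter t‖ = 0
  · rw [h, div_zero]; exact zero_le_one
  · rw [div_self h]

/-- **Registered helper `ss_unstableStarGradient_of_sectorLipschitz` — stub 4 ⇐ TipReturnLoopBound₈ ∧
SectorLipschitz(-3/8).**  The tip return-loop bound `N ≤ 8` and sublattice-Lipschitz regularity of the
unstable character `U = A_{-3/8}` under unit translations of `(Λ, a)` at rate `θ > 3/4` give
`DecayBound unstableSource C' θ` at the SAME rate.  Both hypotheses are open; this is a reduction only.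
[folklore] -/
theorem ss_unstableStarGradient_of_sectorLipschitz :
    (∃ N : ℝ, 0 ≤ N ∧ N ≤ 8 ∧ ∀ (Λ' : Finset HexVertex), hexDomainSimplyConnected Λ' →
      ∀ (t q s : HexVertex), t ∉ Λ' → q ∈ Λ' → s ∈ Λ' → hexGraph.Adj t q → hexGraph.Adj t s → q ≠ s →
        (∑ τ : HexMidEdgeSAW Λ' s(t, q) s(s, t), xc ^ τ.length) ≤ N) →
    (∃ C θ : ℝ, 3 / 4 < θ ∧ 0 ≤ C ∧
      ∀ (T : hexGraph ≃g hexGraph) (β : ℂ), (∀ f : HexVertex, hexCenter (T f) = hexCenter f + β) →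
        ‖β‖ ≤ 1 →
        ∀ (Λ : Finset HexVertex), hexDomainSimplyConnected Λ →
          ∀ (u w : HexVertex), hexGraph.Adj u w → u ∉ Λ → w ∈ Λ →
            ∀ (z : HexVertex) (R : ℝ), 1 ≤ R → Deep Λ z R →
              ‖arrivalSum (Λ.image T) ((s(u, w) : Sym2 HexVertex).map T) (rootAngle u w) (-3 / 8) z -
                  arrivalSum Λ s(u, w) (rootAngle u w) (-3 / 8) z‖ ≤ C * R ^ (-θ) * mass Λ u w z) →
    ∃ C θ : ℝ, 3 / 4 < θ ∧ DecayBound unstableSource C θ := by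
  intro hLoop hLip
  obtain ⟨N, hN0, -, hN⟩ := hLoop
  obtain ⟨C, θ, hθ, hC0, hL⟩ := hLip
  have hHar : NeighbourMassBound (2 + xc⁻¹ + 2 * N) := har_neighbourMassBound_of_loopBound N hN0 hN
  obtain ⟨hT, hcov, -⟩ := ss_translation_covariance
  obtain ⟨C', hD⟩ := ss_decayBound_weightedStar_of_sectorLipschitz (-3 / 8) (2 + xc⁻¹ + 2 * N) C θ
    (fun v t => (starRingEnd ℂ (dartUnit v t)) ^ 2)
    (fun v t => by
      rw [norm_pow, Complex.norm_conj]
      exact pow_le_one₀ (norm_nonneg _) (ss_norm_dartUnit_le_one v t))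
    (fun Λ v hdeep => ss_sum_conj_dartUnit_sq Λ v hdeep) hT
    (fun T β hTβ Λ a θa z => (hcov T β hTβ Λ a θa (-3 / 8) z).1)
    (fun Λ u w v t θa hu hw huw hv ht => ss_norm_arrivalSum_nbr_le Λ u w v t θa (-3 / 8) hu hw huw hv ht)
    hHar hC0 (lt_trans (by norm_num) hθ) hL
  exact ⟨C', θ, hθ, hD⟩

/-- **Registered helper `ss_signalStarGradient_of_sectorLipschitz` — stub 5 ⇐ TipReturnLoopBound₈ ∧
SectorLipschitz(5/8).**  The tip return-loop bound `N ≤ 8` and sublattice-Lipschitz regularity of the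
signal character `S = A_{5/8}` under unit translations of `(Λ, a)` at rate `θ > 3/4` give
`DecayBound signalSource C' θ` at the same rate.  Both hypotheses are open; this is a reduction only.
[folklore] -/
theorem ss_signalStarGradient_of_sectorLipschitz :
    (∃ N : ℝ, 0 ≤ N ∧ N ≤ 8 ∧ ∀ (Λ' : Finset HexVertex), hexDomainSimplyConnected Λ' →
      ∀ (t q s : HexVertex), t ∉ Λ' → q ∈ Λ' → s ∈ Λ' → hexGraph.Adj t q → hexGraph.Adj t s → q ≠ s →
        (∑ τ : HexMidEdgeSAW Λ' s(t, q) s(s, t), xc ^ τ.length) ≤ N) →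
    (∃ C θ : ℝ, 3 / 4 < θ ∧ 0 ≤ C ∧
      ∀ (T : hexGraph ≃g hexGraph) (β : ℂ), (∀ f : HexVertex, hexCenter (T f) = hexCenter f + β) →
        ‖β‖ ≤ 1 →
        ∀ (Λ : Finset HexVertex), hexDomainSimplyConnected Λ →
          ∀ (u w : HexVertex), hexGraph.Adj u w → u ∉ Λ → w ∈ Λ →
            ∀ (z : HexVertex) (R : ℝ), 1 ≤ R → Deep Λ z R →
              ‖arrivalSum (Λ.image T) ((s(u, w) : Sym2 HexVertex).map T) (rootAngle u w) (5 / 8) z -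
                  arrivalSum Λ s(u, w) (rootAngle u w) (5 / 8) z‖ ≤ C * R ^ (-θ) * mass Λ u w z) →
    ∃ C θ : ℝ, 3 / 4 < θ ∧ DecayBound signalSource C θ := by
  intro hLoop hLip
  obtain ⟨N, hN0, -, hN⟩ := hLoop
  obtain ⟨C, θ, hθ, hC0, hL⟩ := hLip
  have hHar : NeighbourMassBound (2 + xc⁻¹ + 2 * N) := har_neighbourMassBound_of_loopBound N hN0 hN
  obtain ⟨hT, hcov, -⟩ := ss_translation_covariance
  obtain ⟨C', hD⟩ := ss_decayBound_weightedStar_of_sectorLipschitz (5 / 8) (2 + xc⁻¹ + 2 * N) C θ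
    (fun v t => starRingEnd ℂ (dartUnit v t))
    (fun v t => by
      rw [Complex.norm_conj]
      exact ss_norm_dartUnit_le_one v t)
    (fun Λ v hdeep => ss_sum_conj_dartUnit Λ v hdeep) hT
    (fun T β hTβ Λ a θa z => (hcov T β hTβ Λ a θa (5 / 8) z).1)
    (fun Λ u w v t θa hu hw huw hv ht => ss_norm_arrivalSum_nbr_le Λ u w v t θa (5 / 8) hu hw huw hv ht)
    hHar hC0 (lt_trans (by norm_num) hθ) hL
  exact ⟨C', θ, hθ, hD⟩

end Summit.CriticalPhenomena.SAWScalingLimit.Theorems.DefectDecoherence.SectorSlaving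

end
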